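import Summits.BirchSwinnertonDyer.Rank1Residual.Iwasawa.UnramifiedClassKernelVanishing
import Summits.BirchSwinnertonDyer.Rank1Residual.X11b.MaxUnramifiedRestriction
import Literature.NumberTheory.EllipticCurves.KummerSelmerStructure
import Literature.NumberTheory.EllipticCurves.SubgroupSelmerProofs
import Literature.NumberTheory.EllipticCurves.SelmerCorankAssembly
import Literature.NumberTheory.EllipticCurves.LocalFrobeniusGenerationProofs
import Literature.NumberTheory.EllipticCurves.HasseWeilGoodReductionFrobeniusProofs
import Literature.NumberTheory.EllipticCurves.KodairaNeronUnramifiedInertiaProofs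
import Literature.NumberTheory.EllipticCurves.ZpExtensionUnramifiedProofs
import Literature.NumberTheory.GaloisRepresentations.InertiaPadicCharacterProofs
import Literature.NumberTheory.GaloisRepresentations.AbsGaloisGroupCompact
import Literature.NumberTheory.EllipticCurves.WeilPairingTateDual
import HarnessLib

/-!
# Unramified classes of `H¹(K_v, E[p])` at `v ∤ p` die over `K_{∞,η}`: the `K_∞`-LEVEL local
# condition of `A_0` for the unramified part of a relaxed Kummer structure
# (cell `b2b-bsdres`, team n1011, seat p10 GEN 4; OWNERS row T-E3g-BUD0, FILE 3b — the local lemma,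
# arithmetic instantiation of `Iwasawa/UnramifiedClassKernelVanishing.lean`)

HONEST FRAMING (cell `b2b-bsdres`, run/shared/lean/b2b/bsd-rank1-residual/, verbatim in every
file): the goal of the cell is to DELETE the COMBINATION-SHAPED residual classes of the
Birch–Swinnerton-Dyer formula for ALL analytic-rank `≤ 1` elliptic curves over `ℚ` — "full BSD
formula for every rank `≤ 1` curve in class `C`" assembled STRICTLY from published theorems — so
that the rank-`≤ 1` remainder becomes exactly the CONSTRUCTION-SHAPED classes, which are TYPED
(missing-input `Prop`s), NOT attempted. This is not "finishing BSD". THEOREMS ONLY (no definition,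
no named fact, nothing asserted).

## What (row T-E3g-BUD0, FILES 1–3)

For an elliptic curve `E = W` over a number field `K`, a prime `p`, a `ℤ_p`-extension `κ`, and a
finite place `v ∤ p` that is NOT totally split in `K_∞` (`∃ σ ∈ Γ_{K_v}, κ(res σ) ≠ 1`; automatic
for the cyclotomic tower, X2 `not_decomp_le_kerSubgroup_of_isCyclotomic`): every class
`c ∈ H¹(Γ_{K_v}, E[p])` in the sum of the UNRAMIFIED subgroup and the local KUMMER condition maps
to `0` in `H¹(Gal(K̄_v/K_{∞,η}), E(K̄_v))` (`η` the prime of `K_∞` above `v` singled out by the chosen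
embedding) — `resH1Hom_localSubgroup_map_eq_zero_of_mem_unramified_sup_kummer`; consequently, for a
global class `y ∈ H¹(K, E[p])` whose localisation at `v` is of that kind, the image
`h_0(Ψ y) ∈ H¹(K_∞, E[p^∞])` satisfies the local condition of `Sel_{p^∞}(E/K_∞)` at `v`
(`layerToInfty_resH1Hom_torsionToPrimaryH1_mem_localKerOver_of_mem_unramified_sup_kummer`) — the
hypothesis `hT` of FILE 2's `resH1Hom_torsionToPrimaryH1_mem_selmerInftyPreimage_zero`.

Ingredients BY NAME: the abstract lemma `Iwasawa.exists_eq_rho_sub_of_apply_eq_one` (FILE 3);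
X11b's `LocBridge.mem_unramifiedSubgroup_one_iff_exists` (unramified ⟺ principal on `absInertia`);
the tree's local structure theorems `exists_isArithFrobAt_localAbsIntegers`,
`exists_eq_frobenius_pow_mul_inertia_mul` (Frobenius + inertia generate), `inertia_eq_absInertia`,
`inertia_normal_of_mem_localPrimesAbove`, `apply_eq_one_of_mem_absInertia` (a `ℤ_p`-valued character
kills inertia at `v ∤ p`), and the cocycle-class dictionary of `KummerSelmerStructure.lean`.

References: Greenberg LNM 1716 §2–§3; Greenberg–Vatsal 2000 p. 17; Washington Prop. 13.2; Serre,
*Galois Cohomology* I.§2, I.§5.1; Neukirch *ANT* II (9.9)–(9.11).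
-/

set_option autoImplicit false

noncomputable section

open scoped Classical

open WeierstrassCurve Literature.NumberTheory.EllipticCurves Literature.NumberTheory.GaloisRepresentations
  NumberField IsDedekindDomain Field CategoryTheory
  Literature.NumberTheory.GaloisRepresentations.IsNonarchimedeanLocalField

namespace Summit.BirchSwinnertonDyer.Rank1Residual.Additive

universe u

variable {K : Type u} [Field K] [NumberField K] (W : WeierstrassCurve K) [W.IsElliptic] (p : ℕ)
  [hp : Fact p.Prime] (κ : ZpExtension K p) (v : HeightOneSpectrum (𝓞 K))

/-! ### §1 A `ℤ_p`-valued character of `Γ_{K_v}` killing Frobenius kills everything -/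

/-- An element of `ℤ_p` divisible by every power of `p` is `0`. [folklore] -/
theorem padicInt_eq_zero_of_forall_pow_dvd' {x : ℤ_[p]} (h : ∀ B : ℕ, (p : ℤ_[p]) ^ B ∣ x) :
    x = 0 := by
  by_contra hx
  have hp' : Prime (p : ℤ_[p]) := PadicInt.irreducible_p.prime
  have h2 : (p : ℤ_[p]) ^ x.valuation * p ∣
      (p : ℤ_[p]) ^ x.valuation * (PadicInt.unitCoeff hx : ℤ_[p]) := by
    rw [← pow_succ, mul_comm, ← PadicInt.unitCoeff_spec hx]
    exact h _
  have h3 : (p : ℤ_[p]) ∣ (PadicInt.unitCoeff hx : ℤ_[p]) :=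
    (mul_dvd_mul_iff_left (pow_ne_zero _ hp'.ne_zero)).mp h2
  exact hp'.not_unit (isUnit_of_dvd_unit h3 (PadicInt.unitCoeff hx).isUnit)

/-! ### §2 The local vanishing -/

/-- **Unramified or Kummer local classes at `v ∤ p` die on `Gal(K̄_v/K_{∞,η})` after passing to
`E(K̄_v)`-coefficients.** For `c ∈ H¹(Γ_{K_v}, E[p])` in `H¹_ur ⊔ 𝓚_v` and `v` not totally split in
`K_∞`: the restriction to the local subgroup `(Γ_{K_v} → Γ_K)⁻¹(ker κ)` of the image of `c` in
`H¹(Γ_{K_v}, E(K̄_v))` vanishes. Kummer part: it already dies in `H¹(Γ_{K_v}, E(K̄_v))`; unramified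
part: FILE 3's `exists_eq_rho_sub_of_apply_eq_one` (inertia `absInertia K_v` is killed by
`κ ∘ res`, a Frobenius is not, Frobenius + inertia generate, `E[p]` is finite `p`-torsion).
[cite: GreenbergLNM1716, §2 (the local conditions of Sel_E(F_∞)_p at η ∤ p)] [cite: Washington1997, Prop. 13.2] -/
theorem resH1Hom_localSubgroup_map_eq_zero_of_mem_unramified_sup_kummer
    (hpv : ((p : ℕ) : 𝓞 K) ∉ v.asIdeal)
    (hdec : ∃ σ : absoluteGaloisGroup (v.adicCompletion K), κ (resGal (K := K) (v.adicCompletion K) σ) ≠ 1)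
    {c : galoisCohomology ((W.torsionGaloisModule (p : ℤ)).restrictField (v.adicCompletion K)) 1}
    (hc : c ∈ DiscreteGaloisModule.unramifiedSubgroup
        ((W.torsionGaloisModule (p : ℤ)).restrictField (v.adicCompletion K)) 1 ⊔
      W.kummerLocalConditionAt (p : ℤ) (v.adicCompletion K)) :
    resH1Hom (Literature.NumberTheory.EllipticCurves.subgroupIncl (localSubgroup κ.kerSubgroup (v.adicCompletion K)))
        (AddMonoidHom.id (localPoints W (v.adicCompletion K))) (fun _ _ ↦ rfl)
      (galoisCohomology.map (W.torsionPointsMapIntertwining (p : ℤ) (v.adicCompletion K)) 1 c) = 0 := by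
  obtain ⟨a, ha, b, hb, rfl⟩ := AddSubgroup.mem_sup.mp hc
  rw [map_add, (W.mem_kummerLocalConditionAt_iff (p : ℤ) (v.adicCompletion K) b).mp hb, add_zero]
  -- the unramified summand `a = [φ]`, principal on the inertia group
  obtain ⟨φ, rfl⟩ := oneCocycleClass_surjective _ a
  obtain ⟨w₀, hw₀⟩ := (X11b.LocBridge.mem_unramifiedSubgroup_one_iff_exists _ φ).mp ha
  -- local structure: a prime `𝔐`, a Frobenius `F`, inertia = `absInertia`
  obtain ⟨𝔐, h𝔐⟩ := v.localPrimesAbove_nonempty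
  obtain ⟨F, hF⟩ := v.exists_isArithFrobAt_localAbsIntegers h𝔐
  obtain ⟨wv, hwv⟩ := v.exists_spectralValuation
  have hIeq : 𝔐.inertia (absoluteGaloisGroup (v.adicCompletion K)) = absInertia (v.adicCompletion K) := v.inertia_eq_absInertia hwv h𝔐
  haveI : (absInertia (v.adicCompletion K)).Normal := hIeq ▸ v.inertia_normal_of_mem_localPrimesAbove h𝔐
  have hgen : ∀ U : Subgroup (absoluteGaloisGroup (v.adicCompletion K)), IsOpen (U : Set (absoluteGaloisGroup (v.adicCompletion K))) →
      ∀ σ, ∃ (n : ℕ) (τ u : absoluteGaloisGroup (v.adicCompletion K)), τ ∈ absInertia (v.adicCompletion K) ∧ u ∈ U ∧ σ = F ^ n * τ * u := by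
    intro U hU σ
    obtain ⟨n, τ, u, hτ, hu, h⟩ := v.exists_eq_frobenius_pow_mul_inertia_mul h𝔐 hF hU σ
    exact ⟨n, τ, u, hIeq ▸ hτ, hu, h⟩
  -- the character `χ = κ ∘ res`
  let χ : absoluteGaloisGroup (v.adicCompletion K) →ₜ* Multiplicative ℤ_[p] :=
    κ.toContinuousMonoidHom.comp (resGal (K := K) (v.adicCompletion K))
  have hχapply : ∀ σ, χ σ = κ (resGal (K := K) (v.adicCompletion K) σ) := fun σ ↦ rfl
  have hχI : ∀ τ ∈ absInertia (v.adicCompletion K), χ τ = 1 := fun τ hτ ↦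
    apply_eq_one_of_mem_absInertia (v.ringChar_residueField_adicCompletion_ne hpv) χ hτ
  have hχF : χ F ≠ 1 := by
    intro hF1
    obtain ⟨σ, hσ⟩ := hdec
    apply hσ
    rw [← hχapply]
    apply Multiplicative.toAdd.injective
    rw [toAdd_one]
    refine padicInt_eq_zero_of_forall_pow_dvd' p fun B ↦ ?_
    -- the open subgroup `{g : p^B ∣ χ g}`
    let V : Subgroup (absoluteGaloisGroup (v.adicCompletion K)) :=
      { carrier := {g | (p : ℤ_[p]) ^ B ∣ Multiplicative.toAdd (χ g)}
        mul_mem' := fun {a b} ha hb ↦ by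
          simp only [Set.mem_setOf_eq, map_mul, toAdd_mul] at ha hb ⊢
          exact dvd_add ha hb
        one_mem' := by simp only [Set.mem_setOf_eq, map_one, toAdd_one, dvd_zero]
        inv_mem' := fun {a} ha ↦ by
          simp only [Set.mem_setOf_eq, map_inv, toAdd_inv] at ha ⊢
          exact (dvd_neg).mpr ha }
    have hVopen : IsOpen (V : Set (absoluteGaloisGroup (v.adicCompletion K))) := by
      have hset : (V : Set (absoluteGaloisGroup (v.adicCompletion K))) = (fun g ↦ Multiplicative.toAdd (χ g)) ⁻¹'
          Metric.closedBall (0 : ℤ_[p]) ((p : ℝ) ^ (-(B : ℤ))) := by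
        ext g
        simp only [SetLike.mem_coe, Set.mem_preimage, Metric.mem_closedBall, dist_zero_right]
        change (p : ℤ_[p]) ^ B ∣ Multiplicative.toAdd (χ g) ↔ _
        rw [PadicInt.norm_le_pow_iff_mem_span_pow, Ideal.mem_span_singleton]
      rw [hset]
      refine (IsUltrametricDist.isOpen_closedBall (0 : ℤ_[p]) ?_).preimage
        (continuous_toAdd.comp (map_continuous χ))
      exact zpow_ne_zero _ (by exact_mod_cast hp.out.ne_zero)
    obtain ⟨n, τ, u, hτ, hu, rfl⟩ := hgen V hVopen σ
    have : χ (F ^ n * τ * u) = χ u := by rw [map_mul, map_mul, map_pow, hF1, one_pow, hχI τ hτ, one_mul, one_mul]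
    rw [this]
    exact hu
  -- the abstract lemma on `X = ρ_E.toTopRep`
  haveI : NeZero p := ⟨hp.out.ne_zero⟩
  haveI : Finite (geomTorsion W (p : ℤ)) := finite_geomTorsion_of_neZero W p
  haveI : Finite (((W.torsionGaloisModule (p : ℤ)).restrictField (v.adicCompletion K)).toTopRep) :=
    inferInstanceAs (Finite (geomTorsion W (p : ℤ)))
  haveI : DiscreteTopology (((W.torsionGaloisModule (p : ℤ)).restrictField (v.adicCompletion K)).toTopRep) := inferInstanceAs (DiscreteTopology (geomTorsion W (p : ℤ)))
  have hM : ∀ m : ((W.torsionGaloisModule (p : ℤ)).restrictField (v.adicCompletion K)).toTopRep, p ^ 1 • m = 0 := fun m ↦ by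
    rw [pow_one]
    exact Subtype.ext (by
      rw [AddSubgroupClass.coe_nsmul, ZeroMemClass.coe_zero]
      exact AddSubgroup.torsionBy.nsmul_iff.mp (m : geomTorsion W (p : ℤ)).2)
  have hcont : ∀ m : ((W.torsionGaloisModule (p : ℤ)).restrictField (v.adicCompletion K)).toTopRep, Continuous fun g : absoluteGaloisGroup (v.adicCompletion K) ↦ ((W.torsionGaloisModule (p : ℤ)).restrictField (v.adicCompletion K)).toTopRep.ρ g m :=
    fun m ↦ ((W.torsionGaloisModule (p : ℤ)).restrictField (v.adicCompletion K)).continuous_apply_left m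
  haveI : CompactSpace (absoluteGaloisGroup (v.adicCompletion K)) :=
    absoluteGaloisGroup_compactSpace (v.adicCompletion K)
  obtain ⟨bb, hbb⟩ := Iwasawa.exists_eq_rho_sub_of_apply_eq_one ((W.torsionGaloisModule (p : ℤ)).restrictField (v.adicCompletion K)).toTopRep hM hcont (absInertia (v.adicCompletion K)) F
    hgen χ hχI hχF φ ⟨w₀, hw₀⟩
  -- the classes
  rw [W.map_torsionPointsMapIntertwining_oneCocycleClass (p : ℤ) (v.adicCompletion K) φ]
  set ψ := contOneCocycles.pullback (ContinuousMonoidHom.id (absoluteGaloisGroup (v.adicCompletion K)))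
      (X := DiscreteGaloisModule.toTopRep (GaloisRep.restrictField (v.adicCompletion K) (W.torsionGaloisModule (p : ℤ))))
      (Y := discreteTopRep (absoluteGaloisGroup (v.adicCompletion K)) (localPoints W (v.adicCompletion K)))
      (TopRep.ofHom ⟨(W.torsionPointsMapIntertwining (p : ℤ) (v.adicCompletion K)).toContinuousLinearMap,
        (W.torsionPointsMapIntertwining (p : ℤ) (v.adicCompletion K)).isIntertwining'⟩) φ with hψ
  have key : resH1Hom (Literature.NumberTheory.EllipticCurves.subgroupIncl (localSubgroup κ.kerSubgroup (v.adicCompletion K)))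
      (AddMonoidHom.id (localPoints W (v.adicCompletion K))) (fun _ _ ↦ rfl)
      (oneCocycleClass (discreteTopRep (absoluteGaloisGroup (v.adicCompletion K)) (localPoints W (v.adicCompletion K))) ψ) =
      oneCocycleClass _ (contOneCocycles.pullback (Literature.NumberTheory.EllipticCurves.subgroupIncl (localSubgroup κ.kerSubgroup (v.adicCompletion K)))
        (resHomOfEquivariant (Literature.NumberTheory.EllipticCurves.subgroupIncl (localSubgroup κ.kerSubgroup (v.adicCompletion K)))
          (AddMonoidHom.id (localPoints W (v.adicCompletion K))) (fun _ _ ↦ rfl)) ψ) :=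
    map_oneCocycleClass _ _ _ ψ
  rw [key, oneCocycleClass_eq_zero_iff]
  refine ⟨pointsMap W (v.adicCompletion K) (bb : geomTorsion W (p : ℤ)), fun g ↦ ?_⟩
  have hg : χ g = 1 := by
    rw [hχapply, ← ZpExtension.mem_kerSubgroup]
    exact (mem_localSubgroup_iff κ.kerSubgroup (v.adicCompletion K) g).mp g.2
  have hφg := hbb g hg
  rw [contOneCocycles.pullback_apply, hψ, contOneCocycles.pullback_apply]
  change (W.torsionPointsMapIntertwining (p : ℤ) (v.adicCompletion K)) (φ.1 (g : absoluteGaloisGroup (v.adicCompletion K))) =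
    (g : absoluteGaloisGroup (v.adicCompletion K)) • pointsMap W (v.adicCompletion K) (bb : geomTorsion W (p : ℤ)) -
      pointsMap W (v.adicCompletion K) (bb : geomTorsion W (p : ℤ))
  rw [hφg, map_sub, torsionPointsMapIntertwining_apply]
  congr 1
  exact pointsMap_smul W (v.adicCompletion K) (g : absoluteGaloisGroup (v.adicCompletion K)) (bb : geomTorsion W (p : ℤ))

/-! ### §3 The `K_∞`-level local condition of `A_0` (the `hT` of FILE 2) -/

/-- **The input `hT` of FILE 2's `resH1Hom_torsionToPrimaryH1_mem_selmerInftyPreimage_zero` at an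
unramified-or-Kummer place `v ∤ p`.** For `y ∈ H¹(K, E[p])` whose localisation at `v` lies in
`H¹_ur(K_v, E[p]) ⊔ 𝓚_v`, and `v` not totally split in `K_∞`, the class
`h_0(Ψ y) ∈ H¹(K_∞, E[p^∞])` satisfies the local condition of `Sel_{p^∞}(E/K_∞)` at the prime of
`K_∞` above `v` singled out by the chosen embedding (`localKerOver p (ker κ) K_v`): restriction
commutes with the local restrictions, and §2. [cite: GreenbergLNM1716, §2–§3 (pp. 85–86)] -/
theorem layerToInfty_resH1Hom_torsionToPrimaryH1_mem_localKerOver_of_mem_unramified_sup_kummer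
    (hpv : ((p : ℕ) : 𝓞 K) ∉ v.asIdeal)
    (hdec : ∃ σ : absoluteGaloisGroup (v.adicCompletion K), κ (resGal (K := K) (v.adicCompletion K) σ) ≠ 1)
    (y : galH1Torsion W (p : ℤ))
    (hy : galoisCohomology.res (W.torsionGaloisModule (p : ℤ)) (v.adicCompletion K) 1 y ∈
      DiscreteGaloisModule.unramifiedSubgroup
        ((W.torsionGaloisModule (p : ℤ)).restrictField (v.adicCompletion K)) 1 ⊔
      W.kummerLocalConditionAt (p : ℤ) (v.adicCompletion K)) :
    W.layerToInfty κ 0 (resH1Hom (Literature.NumberTheory.EllipticCurves.subgroupIncl (κ.layerSubgroup 0))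
        (AddMonoidHom.id (geomPrimaryTorsion W p)) (fun _ _ ↦ rfl) (torsionToPrimaryH1 W p y)) ∈
      W.localKerOver p κ.kerSubgroup (v.adicCompletion K) := by
  rw [mem_localKerOver_iff]
  -- `h_0 ∘ res_{K_0} = res_{K_∞}` on `H¹(K, E[p^∞])`
  have e1 : ∀ c : W.galH1Primary p,
      W.layerToInfty κ 0 (resH1Hom (Literature.NumberTheory.EllipticCurves.subgroupIncl (κ.layerSubgroup 0))
        (AddMonoidHom.id (geomPrimaryTorsion W p)) (fun _ _ ↦ rfl) c) =
      resH1Hom (Literature.NumberTheory.EllipticCurves.subgroupIncl κ.kerSubgroup)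
        (AddMonoidHom.id (geomPrimaryTorsion W p)) (fun _ _ ↦ rfl) c := fun c ↦ by
    change resH1Hom (subgroupInclusion (κ.kerSubgroup_le_layerSubgroup 0))
      (AddMonoidHom.id (geomPrimaryTorsion W p)) (fun _ _ ↦ rfl) (resH1Hom _ _ _ c) = _
    rw [resH1Hom_resH1Hom]
    exact DFunLike.congr_fun (resH1Hom_congr (by ext; rfl) (by ext; rfl) _ _) c
  -- the local restriction over `K_∞` after `res_{K_∞}`
  have e2 : ∀ c : W.galH1Primary p,
      W.localResOver p κ.kerSubgroup (v.adicCompletion K)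
        (resH1Hom (Literature.NumberTheory.EllipticCurves.subgroupIncl κ.kerSubgroup)
          (AddMonoidHom.id (geomPrimaryTorsion W p)) (fun _ _ ↦ rfl) c) =
      resH1Hom (Literature.NumberTheory.EllipticCurves.subgroupIncl
          (localSubgroup κ.kerSubgroup (v.adicCompletion K)))
        (AddMonoidHom.id (localPoints W (v.adicCompletion K))) (fun _ _ ↦ rfl)
        (resH1Hom (resGal (K := K) (v.adicCompletion K))
          ((pointsMap W (v.adicCompletion K)).comp (geomPrimaryTorsion W p).subtype)
          (W.pointsMap_comp_subtype_smul p) c) := fun c ↦ by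
    show resH1Hom (resGalSubgroupOfEmb κ.kerSubgroup (closureEmb (K := K) (v.adicCompletion K)))
        ((pointsMapOfEmb W (closureEmb (K := K) (v.adicCompletion K))).comp
          (geomPrimaryTorsion W p).subtype)
        (W.pointsMapOfEmb_comp_subtype_smul p (closureEmb (K := K) (v.adicCompletion K)) κ.kerSubgroup)
        (resH1Hom (Literature.NumberTheory.EllipticCurves.subgroupIncl κ.kerSubgroup)
          (AddMonoidHom.id (geomPrimaryTorsion W p)) (fun _ _ ↦ rfl) c) = _
    rw [resH1Hom_resH1Hom, resH1Hom_resH1Hom]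
    exact DFunLike.congr_fun (resH1Hom_congr (by ext; rfl) (by ext; rfl) _ _) c
  -- `(E[p] ↪ E[p^∞])_*` then the pair `(resGal, pointsMap ∘ incl)` = W3's `map ∘ res`
  have e3 : resH1Hom (resGal (K := K) (v.adicCompletion K))
        ((pointsMap W (v.adicCompletion K)).comp (geomPrimaryTorsion W p).subtype)
        (W.pointsMap_comp_subtype_smul p) (torsionToPrimaryH1 W p y) =
      galoisCohomology.map (W.torsionPointsMapIntertwining (p : ℤ) (v.adicCompletion K)) 1
        (galoisCohomology.res (W.torsionGaloisModule (p : ℤ)) (v.adicCompletion K) 1 y) := by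
    rw [map_res_torsionGaloisModule_apply, torsionToPrimaryH1, resH1Hom_resH1Hom]
    exact DFunLike.congr_fun (resH1Hom_congr (by ext; rfl) (by ext; rfl) _ _) y
  rw [e1, e2, e3]
  exact resH1Hom_localSubgroup_map_eq_zero_of_mem_unramified_sup_kummer W p κ v hpv hdec hy

end Summit.BirchSwinnertonDyer.Rank1Residual.Additive

end
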